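import Literature.AnabelianGeometry.EtaleTheta.Discharge.Sec3TemperedFrobenioidDataAutPhiTrivialOfRigidOverBase
import Literature.AnabelianGeometry.EtaleTheta.Discharge.Sec3LogDivisorTowerCuspSwapPhiZeroAut
import Literature.AnabelianGeometry.EtaleTheta.Discharge.Sec5JunctionSmallIndexHypotheses
import HarnessLib

/-!
# [EtTh] Def. 3.6 at the design carrier of record `temperedFrobenioidSmall`: IF its base `B^temp(Compat₃′)⁰` is slim, the [IUTchI] Cor. 5.3 (iv)
# injectivity conclusion `RigidOverBase` FAILS there (the cusp swap is a self-equivalence over `id_D` not isomorphic to the identity) — proof-only,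
# the slimness hypothesis DISPLAYED and NOT claimed

S. Mochizuki, *The geometry of Frobenioids I*, Kyushu J. Math. **62** (2008), §0 p. 14 (slim categories), Cor. 5.4 p. 104 (functoriality of the
model category in the data) [cite: MochizukiFrdI2008, Cor. 5.4 p.104]; S. Mochizuki, *The étale theta function …*, Def. 3.6 p. 77
[cite: MochizukiEtTh2009, Def 3.6 p.77].  Consumer locus: [IUTchI] Cor. 5.3 (iv) p. 144 ([IUTchI] Cor 5.3 (iv) p.144) [claim: Mochizuki2012, status: disputed]
(nothing of the series asserted; no side taken on [IUTchIII] Cor. 3.12).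

PROOF-ONLY (cell abc-iut; author abc-iut-L5-t1 gen 13; the CONDITIONAL corollary announced with row «C53IV-DDRPHI-NECESSARY» ★ p543122, within
abc-iut-L5-lead RULINGS #184's allowance «as a theorem with the `IsSlim (…)` instance as an EXPLICIT hypothesis — never as a claim that the instance
exists»).  ONE theorem:

* **`not_rigidOverBase_temperedFrobenioidSmall_of_isSlim (R S) (hsl : IsSlim (ConnectedPart (BTemp (Compat 3 thetaShear))))`** —
  `¬ CatIsomorphism.RigidOverBase (temperedFrobenioidSmall R S).baseFunctorOfCategory`.  ASSEMBLY, all BY NAME: abc-iut-f-193's cusp swap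
  ★ `exists_phiZeroAut_cuspSwap` (a natural automorphism `σ` of `dmSmall.Φ₀` fixing every principal divisor and moving one element) ⇒
  abc-iut-L2-t12's ★ `exists_dataAut_of_phiZeroAut` (a data automorphism `τ` of the engine carrier with `τ.a = pfImageAut σ`, `τ.b = id`) ⇒
  ★ `TemperedFrobenioid.dataAut_a_eq_self_of_rigidOverBase` (★ p543122: at a slim base `RigidOverBase` forces `τ.a = id`) at the element
  `pfImageEquiv (Perfection.of x)` ⇒ `σ x = x` by injectivity of `Φ₀ → Φ₀^pf` (weakly perf-factorial), contradiction.  The [FrdI] Thm 5.2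
  `Hypotheses` are abc-iut-L2-t12's ★ `hypotheses_temperedFrobenioidSmall`; `temperedFrobenioidSmall R S` IS the engine carrier
  `ofPowDiagonalBase hpfSmall powDiagonalBaseSmall …` by definition.

HONEST LABELS: the hypothesis `IsSlim (ConnectedPart (BTemp (Compat 3 thetaShear)))` is DISPLAYED; it is NOT on disk and NOT claimed (it would
follow from `IsTempered` + `IsSlimGroup` of «GRP₃′» via ★ `isSlim_connectedPart_bTemp`, neither of which is decided in the tree); so this file
decides NOTHING unconditionally about the carrier of record.  Read together with ★ p532607 (`¬ DivisorDataRigid` there, unconditional): at this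
DESIGN carrier either the base is not slim (and the telescope's [FrdI] binder `hsl` is uninhabited there) or the (iv) conclusion itself fails —
a statement about OUR class-(b) design carrier (two unlabelled cusps per component), not about print (labelled cusps, [EtTh] Prop. 1.3);
refutable-as-typed at a design carrier ≠ refuted in print; no token is moved; typed ≠ inhabited ≠ proved; nothing here asserts abc proved or refuted.
-/

noncomputable section

namespace Literature.AnabelianGeometry.EtaleTheta

open CategoryTheory Opposite Function Literature.AlgebraicGeometry.Frobenioids Literature.AnabelianGeometry.SemiGraphs
  Literature.IUT.HodgeTheaters

namespace TemperedFrobenioid.DivisorDataRigidRefutation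

open LogDivisorModel.TateTowerThetaTwist ThetaTwistTowerSmallIndex TateTowerKummerTwistRShear

/-- **IF the base of the carrier of record is slim, the (iv) injectivity conclusion FAILS there.**  For the [EtTh] Def 3.6 tempered Frobenioid
`temperedFrobenioidSmall R S` of the ε-free small-index theta tower (abc-iut-L2-t3 / abc-iut-L2-t12; base `B^temp(Compat₃′)⁰`): under the
DISPLAYED hypothesis `IsSlim (ConnectedPart (BTemp (Compat 3 thetaShear)))` (NOT on disk, NOT claimed), `CatIsomorphism.RigidOverBase` of its base
functor is FALSE — abc-iut-f-193's cusp swap (★ `exists_phiZeroAut_cuspSwap`) yields, through abc-iut-L2-t12's ★ `exists_dataAut_of_phiZeroAut`,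
a data automorphism moving a divisor, which ★ `TemperedFrobenioid.dataAut_a_eq_self_of_rigidOverBase` (row «C53IV-DDRPHI-NECESSARY») forbids at a
slim base.  OURS, about OUR design carrier; conditional. [cite: MochizukiFrdI2008, Cor. 5.4 p.104] [cite: MochizukiEtTh2009, Def 3.6 p.77]
[claim: Mochizuki2012, status: disputed] -/
theorem not_rigidOverBase_temperedFrobenioidSmall_of_isSlim
    (R S : ((ConnectedPart (BTemp (Compat 3 thetaShear)))ᵒᵖ ⥤ CommMonCat.{0}) → Prop)
    (hsl : IsSlim (ConnectedPart (BTemp (Compat 3 thetaShear)))) :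
    ¬ CatIsomorphism.RigidOverBase (temperedFrobenioidSmall R S).baseFunctorOfCategory := by
  obtain ⟨σ, hσ, hfix, A, x, hx⟩ := exists_phiZeroAut_cuspSwap
  obtain ⟨τ, hτa, -⟩ := exists_dataAut_of_phiZeroAut hpfSmall powDiagonalBaseSmall
    QuasiTemperoid.BTempConnected.connectedPart_isConnected QuasiTemperoid.BTempConnected.connectedPart_isTotallyEpimorphic
    QuasiTemperoid.BTempConnected.connectedPart_isOfFSMType R S σ hσ hfix
  intro hR
  -- `temperedFrobenioidSmall R S` IS the engine carrier `ofPowDiagonalBase hpfSmall powDiagonalBaseSmall …` (by definition)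
  have hh : ModelFrobenioid.Hypotheses
      (ofPowDiagonalBase hpfSmall powDiagonalBaseSmall QuasiTemperoid.BTempConnected.connectedPart_isConnected
        QuasiTemperoid.BTempConnected.connectedPart_isTotallyEpimorphic QuasiTemperoid.BTempConnected.connectedPart_isOfFSMType R S).divisorMonoid
      (ofPowDiagonalBase hpfSmall powDiagonalBaseSmall QuasiTemperoid.BTempConnected.connectedPart_isConnected
        QuasiTemperoid.BTempConnected.connectedPart_isTotallyEpimorphic QuasiTemperoid.BTempConnected.connectedPart_isOfFSMType R S).ratFnFunctor :=
    hypotheses_temperedFrobenioidSmall R S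
  have hR' : CatIsomorphism.RigidOverBase
      (ofPowDiagonalBase hpfSmall powDiagonalBaseSmall QuasiTemperoid.BTempConnected.connectedPart_isConnected
        QuasiTemperoid.BTempConnected.connectedPart_isTotallyEpimorphic QuasiTemperoid.BTempConnected.connectedPart_isOfFSMType R S).baseFunctorOfCategory :=
    hR
  apply hx
  have h := (ofPowDiagonalBase hpfSmall powDiagonalBaseSmall QuasiTemperoid.BTempConnected.connectedPart_isConnected
      QuasiTemperoid.BTempConnected.connectedPart_isTotallyEpimorphic QuasiTemperoid.BTempConnected.connectedPart_isOfFSMType R S).dataAut_a_eq_self_of_rigidOverBase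
    hh hsl hR' τ (op A)
    (pfImageEquiv hpfSmall powDiagonalBaseSmall QuasiTemperoid.BTempConnected.connectedPart_isConnected
      QuasiTemperoid.BTempConnected.connectedPart_isTotallyEpimorphic QuasiTemperoid.BTempConnected.connectedPart_isOfFSMType R S (op A)
      (Literature.AlgebraicGeometry.Frobenioids.Perfection.of _ x))
  rw [hτa, pfImageAut_apply] at h
  have h' := (pfImageEquiv hpfSmall powDiagonalBaseSmall _ _ _ R S (op A)).injective h
  have hinj : Injective (Literature.AlgebraicGeometry.Frobenioids.Perfection.of (dmSmall.Φ₀.obj (op (equivConn.inverse.obj A)) : Type)) :=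
    of_injective_of_isSharp_isIntegral_isSaturated (hpfSmall _).weak.isDivisorial.isSharp
      (hpfSmall _).weak.isDivisorial.isPreDivisorial.isIntegral (hpfSmall _).weak.isDivisorial.isPreDivisorial.isSaturated
  exact hinj h'

end TemperedFrobenioid.DivisorDataRigidRefutation

end Literature.AnabelianGeometry.EtaleTheta

end
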